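import Summits.CriticalPhenomena.PercolationContinuityZ3.Theorems.SahiMasterFamilyHSharpEight
import Summits.CriticalPhenomena.PercolationContinuityZ3.Theorems.SahiMasterFamilyHSharpThree
import Summits.CriticalPhenomena.PercolationContinuityZ3.Theorems.SahiMasterFamilyPhiCylinder

/-!
# H♯ needs supermultiplicativity: the typed conjectures SH♯ (H♯ on the supermultiplicative part of the union-closed hull) and GH♯
# (H♯ for G-systems), with the kernel ladder SH♯ ⟹ GH♯ ⟹ (GH)_k = PC-k, their status for k ≤ 3, and the necessity of the new hypothesis

Unit `prim-masterthm-p4` (gen 20; crux anchor stmt-CriticalPhenomena-4575, helper work; memo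
`run/shared/lean/prim/prim-masterthm/prim-masterthm-p4/P4-GEN20-REPORT.md` §2–§4).  Companion of `…SahiMasterFamilyHSharp` (gen 17: `HSharp.HSharpNonneg k`
= H♯(k): `Σ_t Φ_k(cap_t β) ≤ k·Φ_k(β)` at EVERY mixture `β` of indicators of union-closed families `∋ univ`), `…SahiMasterFamilyHSharpEight` (gen 20:
`¬ HSharpNonneg 8`, the BI-GLUED mixture) and `…SahiMasterFamilyGHConjecture` / `…GSystems` (gen 15: `GSystemNonneg k` = (GH)_k ⟺ Sahi's `C_k` on the
principal-cap stratum; G-system moment functions are supermultiplicative, `GSystems.gsystem_supermul`).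

WHAT GEN 20 FOUND (exact; memo §2, §4).  H♯ is false on the union-closed HULL from `k = 8` on, but the refuting point `β = ½1_{𝒢₁} + ½1_{𝒢₂}` is NOT
supermultiplicative (`β_S·β_{S'} ≤ β_{S∪S'}` fails for a pure set of each block, `not_supermul_qγ` below), hence is not the moment function of any
G-system; and in every test (adversarial monotone couplings of up to three coins and penalty-annealing over supermultiplicative mixtures, k ≤ 8; the
G-system couplings of the bi-glued families on a (p,q)-grid, k ≤ 24) the H♯ inequality HOLDS on supermultiplicative hull points, with equality only at
the glued vertices.  Recall the complementary fact (gen 15, `…PhiSymmetric`): supermultiplicativity ALONE (`PhiNonneg`, = F(k)) does not even give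
`Φ ≥ 0` (false at k = 16, the witness lying outside the hull).  So BOTH structures carried by a G-system — "mixture of union-closed indicators" (the hull)
and "supermultiplicative" (Harris) — are needed, and together they are (conjecturally) enough for the SHARP inequality:
* `SHSharpNonneg k` — **CONJECTURE SH♯(k)**: H♯(k) for every hull point `β` that is supermultiplicative.  A conjecture-valued definition, never a fact.
* `GHSharpNonneg k` — **CONJECTURE GH♯(k)**: H♯(k) for the moment function `S ↦ μ_p(G_S)` of every normalised G-system of increasing events on a finite
  product space.  A conjecture-valued definition, never a fact.
* KERNEL: `shSharpNonneg_of_hSharpNonneg`, `ghSharpNonneg_of_shSharpNonneg` (a G-system's moment function is the `μ_p`-mixture of the indicators of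
  `𝒢(ω) = {S : ω ∈ G_S}` AND is supermultiplicative), `gSystemNonneg_of_ghSharpNonneg` (caps are `≥ 0`), hence **SH♯(k) ⟹ GH♯(k) ⟹ (GH)_k**;
  `shSharpNonneg_of_le_three`, `ghSharpNonneg_of_le_three` (from H♯(k), k ≤ 3); **`hSharp_of_qp`: H♯ at every QUOTIENT-POSITIVE point, EVERY k** (hereditarily honest by
  `…PhiCylinder`, then `PhiVertexSharp.phiSet_cap_le` index by index), hence `hSharp_of_minClosed` (chains of union-closed families = G-systems over one coin or a
  chain lattice), `hSharp_of_prod_minClosed`, **`hSharp_of_cylinderSystem` (the whole log-linear hull of the vertices; intersection-type G-systems)**;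
  and `not_supermul_qγ`: the gen-20 witness against H♯(8) violates the
  new hypothesis (so `¬ HSharpNonneg 8` does not touch SH♯(8)); `topFree_supermul_hull_negative_three`: WITHOUT the top the class is not even
  Φ-positive at n = 3 (Φ_3 = −⅛ at the uniform mixture of 2^{01}, 2^{12}, 2^{02}, {|S|≥2}), so SUC points are not hereditarily honest in general.
Both new hypotheses are hereditary under the recursion's restriction-with-top-reset (memo §4), which is what an induction on `k` needs.
HONEST FRAMING: typed conjectures and reductions only; SH♯/GH♯ (k ≥ 4), (UC-hull)_k (k ≥ 8), (GH)_k (k ≥ 8), Sahi's `C_k`, Kahn's Conjecture 5 and the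
master theorem remain OPEN.  Axioms standard (the imported computational file is used only through `HSharpEight.qγ`'s definition). [this work]
-/

noncomputable section

open scoped Classical

namespace Summit.CriticalPhenomena.PercolationContinuityZ3.Theorems

namespace SHSharp

open Finset
open Literature.Combinatorics.Sahi2008
open Literature.Probability.Percolation.DecisionTree (ind ind_of_mem ind_of_not_mem ind_nonneg)
open PrincipalCapBeta (phiSet)
open HSharp (HSharpNonneg)
open GHConjecture (GSystemNonneg)

/-- **Conjecture SH♯(k)** — H♯ on the SUPERMULTIPLICATIVE part of the union-closed hull: for every finite mixture `β = Σ_x w_x 1_{𝒰_x}` of indicators of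
union-closed families containing `univ` which moreover satisfies `β_S·β_T ≤ β_{S∪T}` for all `S, T`:  `Σ_t Φ_k(cap_t β) ≤ k·Φ_k(β)`.  A conjecture-valued
definition, never a fact. [this work] [status: open k ≥ 4; true k ≤ 3; no violation in adversarial searches k ≤ 8 and structured families k ≤ 24;
WITHOUT supermultiplicativity false from k = 8 (`HSharpEight.not_hSharpNonneg_eight`)] -/
@[conjecture] def SHSharpNonneg (k : ℕ) : Prop :=
  ∀ (α : Type) [Fintype α] (w : α → ℝ) (𝒰 : α → Finset (Finset (Fin k))),
    (∀ x, 0 ≤ w x) → ∑ x, w x = 1 → (∀ x, ∀ A ∈ 𝒰 x, ∀ A' ∈ 𝒰 x, A ∪ A' ∈ 𝒰 x) → (∀ x, univ ∈ 𝒰 x) →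
      (∀ S T : Finset (Fin k), (∑ x, w x * (if S ∈ 𝒰 x then (1 : ℝ) else 0)) * (∑ x, w x * (if T ∈ 𝒰 x then (1 : ℝ) else 0)) ≤
          ∑ x, w x * (if S ∪ T ∈ 𝒰 x then (1 : ℝ) else 0)) →
      ∑ t : Fin k, phiSet k (fun S => if t ∈ S then 1 else ∑ x, w x * (if S ∈ 𝒰 x then (1 : ℝ) else 0)) ≤
        (k : ℝ) * phiSet k (fun S => ∑ x, w x * (if S ∈ 𝒰 x then (1 : ℝ) else 0))

/-- **Conjecture GH♯(k)** — H♯ for G-systems: for every normalised G-system of increasing events `G_S` (`G_S ∩ G_T ⊆ G_{S∪T}`, `G_univ` = everything) on a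
finite product space, the moment function `β_S = μ_p(G_S)` satisfies `Σ_t Φ_k(cap_t β) ≤ k·Φ_k(β)`.  A conjecture-valued definition, never a fact.
[this work] [status: open k ≥ 4; true k ≤ 3; no violation in adversarial monotone-coupling searches k ≤ 8] -/
@[conjecture] def GHSharpNonneg (k : ℕ) : Prop :=
  ∀ (ι : Type) [Fintype ι] (p : ι → unitInterval) (G : Finset (Fin k) → Set (Set ι)),
    (∀ S, IsUpperSet (G S)) → (∀ S T, G S ∩ G T ⊆ G (S ∪ T)) → G univ = Set.univ →
      ∑ t : Fin k, phiSet k (fun S => if t ∈ S then 1 else ex (bernoulliWeight p) (ind (G S))) ≤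
        (k : ℝ) * phiSet k (fun S => ex (bernoulliWeight p) (ind (G S)))

variable {k : ℕ}

/-- H♯(k) ⟹ SH♯(k) (drop the extra hypothesis). [this work] -/
theorem shSharpNonneg_of_hSharpNonneg (h : HSharpNonneg k) : SHSharpNonneg k :=
  fun α _ w 𝒰 hw0 hw1 hUC htop _ => h α w 𝒰 hw0 hw1 hUC htop

/-- **SH♯(k) ⟹ GH♯(k)**: the moment function of a G-system is the `μ_p`-mixture of the indicators of the union-closed families `𝒢(ω) = {S : ω ∈ G_S} ∋ univ`
and is supermultiplicative (Harris, `GSystems.gsystem_supermul`). [this work] -/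
theorem ghSharpNonneg_of_shSharpNonneg (h : SHSharpNonneg k) : GHSharpNonneg k := by
  intro ι _ p G hup hG htop
  set 𝒢 : Set ι → Finset (Finset (Fin k)) := fun ω => univ.filter fun S => ω ∈ G S with h𝒢
  have hUC : ∀ ω, ∀ A ∈ 𝒢 ω, ∀ A' ∈ 𝒢 ω, A ∪ A' ∈ 𝒢 ω := by
    intro ω A hA A' hA'
    simp only [h𝒢, mem_filter, mem_univ, true_and] at hA hA' ⊢
    exact hG A A' ⟨hA, hA'⟩
  have htopmem : ∀ ω, univ ∈ 𝒢 ω := fun ω => by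
    simp only [h𝒢, mem_filter, mem_univ, true_and, htop, Set.mem_univ]
  have hβ : ∀ S, ex (bernoulliWeight p) (ind (G S)) = ∑ ω, bernoulliWeight p ω * (if S ∈ 𝒢 ω then (1 : ℝ) else 0) := by
    intro S
    rw [ex_def]
    refine sum_congr rfl fun ω _ => ?_
    by_cases hω : ω ∈ G S
    · rw [ind_of_mem hω, if_pos (by simp only [h𝒢, mem_filter, mem_univ, true_and]; exact hω)]
    · rw [ind_of_not_mem hω, if_neg (by simp only [h𝒢, mem_filter, mem_univ, true_and]; exact hω)]
  have hβ' : (fun S => ex (bernoulliWeight p) (ind (G S))) =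
      fun S => ∑ ω, bernoulliWeight p ω * (if S ∈ 𝒢 ω then (1 : ℝ) else 0) := funext hβ
  have hcap : ∀ t : Fin k, (fun S => if t ∈ S then 1 else ex (bernoulliWeight p) (ind (G S))) =
      fun S => if t ∈ S then 1 else ∑ ω, bernoulliWeight p ω * (if S ∈ 𝒢 ω then (1 : ℝ) else 0) := by
    intro t; funext S; rw [hβ S]
  have hsup : ∀ S T : Finset (Fin k),
      (∑ ω, bernoulliWeight p ω * (if S ∈ 𝒢 ω then (1 : ℝ) else 0)) * (∑ ω, bernoulliWeight p ω * (if T ∈ 𝒢 ω then (1 : ℝ) else 0)) ≤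
        ∑ ω, bernoulliWeight p ω * (if S ∪ T ∈ 𝒢 ω then (1 : ℝ) else 0) := by
    intro S T
    rw [← hβ S, ← hβ T, ← hβ (S ∪ T)]
    exact GSystems.gsystem_supermul p G hup hG S T
  have hmain := h (Set ι) (bernoulliWeight p) 𝒢 (fun ω => (isFKGMeasure_bernoulliWeight p).nonneg ω)
    (isFKGMeasure_bernoulliWeight p).sum_eq_one hUC htopmem hsup
  simp only [hcap, hβ']
  exact hmain

/-- **GH♯(k) ⟹ (GH)_k**: every capped functional is `≥ 0` (`HSharp.phiSet_capAt_nonneg`, moments `≤ 1`), so `k·Φ(β) ≥ 0`. [this work] -/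
theorem gSystemNonneg_of_ghSharpNonneg (h : GHSharpNonneg k) : GSystemNonneg k := by
  intro ι _ p G hup hG htop
  rcases Nat.eq_zero_or_pos k with hk | hk
  · subst hk
    exact PhiProduct.phiSet_zero_nonneg _
  · obtain ⟨k', rfl⟩ : ∃ k', k = k' + 1 := ⟨k - 1, (Nat.sub_add_cancel hk).symm⟩
    have hH := h ι p G hup hG htop
    have hsum : 0 ≤ ∑ t : Fin (k' + 1), phiSet (k' + 1) (fun S => if t ∈ S then 1 else ex (bernoulliWeight p) (ind (G S))) :=
      sum_nonneg fun t _ => HSharp.phiSet_capAt_nonneg _ (fun B => GSystems.gsystem_le_one p G B) t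
    have hpos : (0 : ℝ) < ((k' + 1 : ℕ) : ℝ) := by exact_mod_cast hk
    nlinarith [hH, hsum, hpos]

/-- Down the ladder: **SH♯(k) ⟹ (GH)_k** (= PC-k, Sahi's `C_k` on the principal-cap stratum, `…GHConverse`). [this work] -/
theorem gSystemNonneg_of_shSharpNonneg (h : SHSharpNonneg k) : GSystemNonneg k :=
  gSystemNonneg_of_ghSharpNonneg (ghSharpNonneg_of_shSharpNonneg h)

/-! ### Status for small `k` -/

/-- H♯(0) (both sides vanish). [this work] -/
theorem hSharpNonneg_zero : HSharpNonneg 0 := by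
  intro α _ w 𝒰 _ _ _ _
  simp

/-- SH♯(k) for `k ≤ 3` (from H♯(k): `hSharpNonneg_zero/one/two`, `HSharp.hSharpNonneg_three`). [this work] -/
theorem shSharpNonneg_of_le_three (hk : k ≤ 3) : SHSharpNonneg k := by
  refine shSharpNonneg_of_hSharpNonneg ?_
  interval_cases k
  · exact hSharpNonneg_zero
  · exact HSharp.hSharpNonneg_one
  · exact HSharp.hSharpNonneg_two
  · exact HSharp.hSharpNonneg_three

/-- GH♯(k) for `k ≤ 3`. [this work] -/
theorem ghSharpNonneg_of_le_three (hk : k ≤ 3) : GHSharpNonneg k :=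
  ghSharpNonneg_of_shSharpNonneg (shSharpNonneg_of_le_three hk)

/-! ### An infinite stratum, every order: H♯ at every QUOTIENT-POSITIVE point — min-closed points, their products, all cylinder systems -/

/-- **H♯ at every quotient-positive point, every order.**  If `β ≤ 1`, `β univ = 1` and every quotient of `β` along pairwise disjoint blocks has `Φ ≥ 0`
(gen 14's QUOTIENT POSITIVITY, `…PhiCylinder`), then `Σ_t Φ(cap_t β) ≤ (k+1)·Φ(β)` — indeed `Φ(cap_t β) ≤ Φ(β)` for every single `t`: quotient-positive points are
hereditarily honest (`PhiCylinder.phiSet_map_nonneg_of_qp`), so the sharp abstract step `PhiVertexSharp.phiSet_cap_le` applies after moving `t` to the last index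
(`PhiCert.phiSet_actV`). [this work] -/
theorem hSharp_of_qp (β : Finset (Fin (k + 1)) → ℝ) (h1 : ∀ B, β B ≤ 1) (huniv : β univ = 1)
    (hqp : ∀ (L : ℕ) (B : Fin L → Finset (Fin (k + 1))), (∀ i j, i ≠ j → Disjoint (B i) (B j)) →
      0 ≤ phiSet L (fun Q => β (Q.biUnion B))) :
    ∑ t : Fin (k + 1), phiSet (k + 1) (fun S => if t ∈ S then 1 else β S) ≤ ((k + 1 : ℕ) : ℝ) * phiSet (k + 1) β := by
  have hterm : ∀ t : Fin (k + 1), phiSet (k + 1) (fun S => if t ∈ S then 1 else β S) ≤ phiSet (k + 1) β := by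
    intro t
    set σ : Equiv.Perm (Fin (k + 1)) := Equiv.swap t (Fin.last k) with hσ
    have hmem : ∀ S : Finset (Fin (k + 1)), t ∈ S.map σ.toEmbedding ↔ Fin.last k ∈ S := by
      intro S
      rw [Finset.mem_map_equiv]
      have : σ.symm t = Fin.last k := by rw [hσ, Equiv.symm_swap, Equiv.swap_apply_left]
      rw [this]
    have e1 : PhiCert.actV σ (fun S => if t ∈ S then 1 else β S) =
        fun S => if Fin.last k ∈ S then 1 else PhiCert.actV σ β S := by
      funext S
      unfold PhiCert.actV
      simp only [hmem]
    rw [← PhiCert.phiSet_actV σ (fun S => if t ∈ S then 1 else β S), e1, ← PhiCert.phiSet_actV σ β]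
    refine PhiVertexSharp.phiSet_cap_le (PhiCert.actV σ β) (fun B => h1 _) (by rw [PhiCert.actV_univ]; exact huniv) ?_
    intro n e _
    have e2 : (fun S : Finset (Fin (n + 1)) => PhiCert.actV σ β (S.map e)) = fun S => β (S.map (e.trans σ.toEmbedding)) := by
      funext S
      unfold PhiCert.actV
      rw [Finset.map_map]
    rw [e2]
    exact PhiCylinder.phiSet_map_nonneg_of_qp β hqp (n + 1) (e.trans σ.toEmbedding)
  calc ∑ t : Fin (k + 1), phiSet (k + 1) (fun S => if t ∈ S then 1 else β S)
      ≤ ∑ _t : Fin (k + 1), phiSet (k + 1) β := sum_le_sum fun t _ => hterm t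
    _ = ((k + 1 : ℕ) : ℝ) * phiSet (k + 1) β := by rw [sum_const, card_univ, Fintype.card_fin, nsmul_eq_mul]

/-- **H♯ at every MIN-CLOSED point, every order** (`β(S ∪ T) ≥ min(β S, β T)`: mixtures of CHAINS of union-closed families = G-systems over one coin or over a
chain lattice; Lieb–Sahi's pure chains).  Min-closed points are supermultiplicative hull points, so this is SH♯ on that stratum. [this work] -/
theorem hSharp_of_minClosed (β : Finset (Fin (k + 1)) → ℝ) (h0 : ∀ B, 0 ≤ β B) (h1 : ∀ B, β B ≤ 1) (huniv : β univ = 1)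
    (hmin : ∀ S T, min (β S) (β T) ≤ β (S ∪ T)) :
    ∑ t : Fin (k + 1), phiSet (k + 1) (fun S => if t ∈ S then 1 else β S) ≤ ((k + 1 : ℕ) : ℝ) * phiSet (k + 1) β :=
  hSharp_of_qp β h1 huniv (PhiCylinder.qp_of_minClosed β h0 h1 hmin)

/-- **H♯ on all finite PRODUCTS of min-closed points, every order** (independent intersections of chains; gen 14's quotient-positive monoid). [this work] -/
theorem hSharp_of_prod_minClosed {X : Type*} (s : Finset X) (β : X → Finset (Fin (k + 1)) → ℝ)
    (h0 : ∀ x ∈ s, ∀ B, 0 ≤ β x B) (h1 : ∀ x ∈ s, ∀ B, β x B ≤ 1) (huniv : ∀ x ∈ s, β x univ = 1)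
    (hmin : ∀ x ∈ s, ∀ S T, min (β x S) (β x T) ≤ β x (S ∪ T)) :
    ∑ t : Fin (k + 1), phiSet (k + 1) (fun S => if t ∈ S then 1 else ∏ x ∈ s, β x S) ≤
      ((k + 1 : ℕ) : ℝ) * phiSet (k + 1) (fun S => ∏ x ∈ s, β x S) :=
  hSharp_of_qp _ (fun B => prod_le_one (fun x hx => h0 x hx B) (fun x hx => h1 x hx B))
    (prod_eq_one fun x hx => huniv x hx)
    (PhiCylinder.qp_finset_prod β s fun x hx => PhiCylinder.qp_of_minClosed (β x) (h0 x hx) (h1 x hx) (hmin x hx))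

/-- **H♯ on every CYLINDER SYSTEM `β_S = ∏_{x ∈ C(S)} q_x`** (`q ∈ [0,1]^X`, `C(S ∪ T) ⊆ C(S) ∪ C(T)`, `C(univ) = ∅`) — the whole log-linear hull of the
vertices `1_𝒰` (gen 14), every order. [this work] -/
theorem hSharp_of_cylinderSystem {X : Type*} [Fintype X] (C : Finset (Fin (k + 1)) → Finset X)
    (hC : ∀ S T, C (S ∪ T) ⊆ C S ∪ C T) (htop : C univ = ∅) (q : X → ℝ) (hq0 : ∀ x, 0 ≤ q x) (hq1 : ∀ x, q x ≤ 1) :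
    ∑ t : Fin (k + 1), phiSet (k + 1) (fun S => if t ∈ S then 1 else ∏ x ∈ C S, q x) ≤
      ((k + 1 : ℕ) : ℝ) * phiSet (k + 1) (fun S => ∏ x ∈ C S, q x) := by
  have hfun : (fun S : Finset (Fin (k + 1)) => ∏ x ∈ C S, q x) = fun S => ∏ x ∈ (univ : Finset X), (if x ∈ C S then q x else 1) := by
    funext S
    rw [prod_ite_mem, univ_inter]
  have hcap : ∀ t : Fin (k + 1), (fun S : Finset (Fin (k + 1)) => if t ∈ S then 1 else ∏ x ∈ C S, q x) =
      fun S => if t ∈ S then 1 else ∏ x ∈ (univ : Finset X), (if x ∈ C S then q x else 1) := by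
    intro t; funext S; rw [prod_ite_mem, univ_inter]
  simp only [hcap]
  rw [hfun]
  refine hSharp_of_prod_minClosed univ (fun x S => if x ∈ C S then q x else 1) (fun x _ B => ?_) (fun x _ B => ?_) (fun x _ => ?_)
    (fun x _ S T => PhiCylinder.minClosed_cylinderFactor C hC (hq1 x) x S T)
  · show 0 ≤ (if x ∈ C B then q x else 1); split_ifs <;> [exact hq0 x; exact zero_le_one]
  · show (if x ∈ C B then q x else 1) ≤ 1; split_ifs <;> [exact hq1 x; exact le_rfl]
  · show (if x ∈ C univ then q x else 1) = 1; rw [htop]; simp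

/-! ### The new hypothesis is necessary: the bi-glued witness against H♯(8) is not supermultiplicative -/

/-- The bi-glued point `qγ` of `…HSharpEight` (which violates H♯(8)) is NOT supermultiplicative: for the singletons `{0} ⊆ B₁`, `{4} ⊆ B₂` one has
`β_{0} = β_{4} = ½` but `β_{0,4} = 0`. [this work] -/
theorem not_supermul_qγ : ¬ ∀ S T : Finset (Fin 8), HSharpEight.qγ S * HSharpEight.qγ T ≤ HSharpEight.qγ (S ∪ T) := by
  intro h
  have e1 : ¬ (({0} : Finset (Fin 8)) ∩ HSharpEight.blk1 = ∅ ∨ HSharpEight.blk1 ⊆ {0} ∨ HSharpEight.blk2 ⊆ {0}) := by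
    unfold HSharpEight.blk1 HSharpEight.blk2; decide
  have e2 : (({0} : Finset (Fin 8)) ∩ HSharpEight.blk2 = ∅ ∨ HSharpEight.blk2 ⊆ {0} ∨ HSharpEight.blk1 ⊆ {0}) := by
    unfold HSharpEight.blk1 HSharpEight.blk2; decide
  have e3 : (({4} : Finset (Fin 8)) ∩ HSharpEight.blk1 = ∅ ∨ HSharpEight.blk1 ⊆ {4} ∨ HSharpEight.blk2 ⊆ {4}) := by
    unfold HSharpEight.blk1 HSharpEight.blk2; decide
  have e4 : ¬ (({4} : Finset (Fin 8)) ∩ HSharpEight.blk2 = ∅ ∨ HSharpEight.blk2 ⊆ {4} ∨ HSharpEight.blk1 ⊆ {4}) := by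
    unfold HSharpEight.blk1 HSharpEight.blk2; decide
  have e5 : ¬ (({0} ∪ {4} : Finset (Fin 8)) ∩ HSharpEight.blk1 = ∅ ∨ HSharpEight.blk1 ⊆ {0} ∪ {4} ∨ HSharpEight.blk2 ⊆ {0} ∪ {4}) := by
    unfold HSharpEight.blk1 HSharpEight.blk2; decide
  have e6 : ¬ (({0} ∪ {4} : Finset (Fin 8)) ∩ HSharpEight.blk2 = ∅ ∨ HSharpEight.blk2 ⊆ {0} ∪ {4} ∨ HSharpEight.blk1 ⊆ {0} ∪ {4}) := by
    unfold HSharpEight.blk1 HSharpEight.blk2; decide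
  have h0 : HSharpEight.qγ {0} = 1 / 2 := by
    simp only [HSharpEight.qγ, HSharpEight.glue, Finset.mem_filter, Finset.mem_univ, true_and, if_neg e1, if_pos e2]; norm_num
  have h4 : HSharpEight.qγ {4} = 1 / 2 := by
    simp only [HSharpEight.qγ, HSharpEight.glue, Finset.mem_filter, Finset.mem_univ, true_and, if_pos e3, if_neg e4]; norm_num
  have h04 : HSharpEight.qγ ({0} ∪ {4}) = 0 := by
    simp only [HSharpEight.qγ, HSharpEight.glue, Finset.mem_filter, Finset.mem_univ, true_and, if_neg e5, if_neg e6]; norm_num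
  have := h {0} {4}
  rw [h0, h4, h04] at this
  norm_num at this

/-! ### The TOP-FREE analogue is false already at `n = 3`: supermultiplicative hull points need not be hereditarily honest -/

/-- The card profile `(0 ↦ 0, 1 ↦ ½, 2 ↦ ½, 3 ↦ ¼)` on `Finset (Fin 3)`. [this work] -/
def profile3 (S : Finset (Fin 3)) : ℝ :=
  if S.card = 0 then 0 else if S.card = 3 then 1 / 4 else 1 / 2

/-- The four union-closed families on `Fin 3` (none contains `univ` except the last): `2^{{0,1}} ∖ ∅`, `2^{{1,2}} ∖ ∅`, `2^{{0,2}} ∖ ∅`, `{S : |S| ≥ 2}`. [this work] -/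
def famW : Fin 4 → Finset (Finset (Fin 3)) :=
  ![univ.filter fun S => S.Nonempty ∧ S ⊆ {0, 1}, univ.filter fun S => S.Nonempty ∧ S ⊆ {1, 2},
    univ.filter fun S => S.Nonempty ∧ S ⊆ {0, 2}, univ.filter fun S => 2 ≤ S.card]

/-- Each of the four families is closed under unions. [this work] -/
theorem famW_unionClosed : ∀ x : Fin 4, ∀ A ∈ famW x, ∀ A' ∈ famW x, A ∪ A' ∈ famW x := by
  decide

/-- The uniform mixture of the four families is the card profile `profile3`. [this work] -/
theorem mixture_famW (S : Finset (Fin 3)) : (∑ x : Fin 4, (1 / 4 : ℝ) * (if S ∈ famW x then (1 : ℝ) else 0)) = profile3 S := by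
  have key : ∀ S : Finset (Fin 3), ((Finset.univ : Finset (Fin 4)).filter fun x => S ∈ famW x).card =
      (if S.card = 0 then 0 else if S.card = 3 then 1 else 2) := by
    decide
  rw [← sum_filter_add_sum_filter_not univ (fun x => S ∈ famW x)]
  have h1 : ∑ x ∈ univ.filter (fun x => S ∈ famW x), (1 / 4 : ℝ) * (if S ∈ famW x then (1 : ℝ) else 0) =
      ∑ x ∈ univ.filter (fun x => S ∈ famW x), (1 / 4 : ℝ) :=
    sum_congr rfl fun x hx => by rw [if_pos (mem_filter.1 hx).2, mul_one]
  have h2 : ∑ x ∈ univ.filter (fun x => ¬ S ∈ famW x), (1 / 4 : ℝ) * (if S ∈ famW x then (1 : ℝ) else 0) = 0 :=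
    sum_eq_zero fun x hx => by rw [if_neg (mem_filter.1 hx).2, mul_zero]
  rw [h1, h2, add_zero, sum_const, key S, nsmul_eq_mul, profile3]
  have hc : S.card ≤ 3 := by simpa using card_le_univ S
  split_ifs <;> push_cast <;> ring

/-- **Supermultiplicativity does NOT make top-free hull points honest (`n = 3`).**  The uniform mixture of the union-closed families `2^{{0,1}}∖∅`,
`2^{{1,2}}∖∅`, `2^{{0,2}}∖∅`, `{S : |S| ≥ 2}` of subsets of `Fin 3` (the top `univ` lies in only one of them) is supermultiplicative
(`β_S = ½` for `1 ≤ |S| ≤ 2`, `β_univ = ¼`) but has **`Φ_3 = 2·¼ + ⅛ − 3·¼ = −⅛ < 0`**.  So a supermultiplicative hull point of a larger ground set need not be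
hereditarily honest, and an induction for SH♯ cannot rest on the sign of the honest sub-functionals alone (for G-systems the sub-functionals ARE moment
functions of G-systems — their positivity is the general Sahi/Kahn positivity one order down). [this work] -/
theorem topFree_supermul_hull_negative_three :
    ∃ (w : Fin 4 → ℝ) (𝒰 : Fin 4 → Finset (Finset (Fin 3))),
      (∀ x, 0 ≤ w x) ∧ ∑ x, w x = 1 ∧ (∀ x, ∀ A ∈ 𝒰 x, ∀ A' ∈ 𝒰 x, A ∪ A' ∈ 𝒰 x) ∧
      (∀ S T : Finset (Fin 3), (∑ x, w x * (if S ∈ 𝒰 x then (1 : ℝ) else 0)) * (∑ x, w x * (if T ∈ 𝒰 x then (1 : ℝ) else 0)) ≤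
          ∑ x, w x * (if S ∪ T ∈ 𝒰 x then (1 : ℝ) else 0)) ∧
      phiSet 3 (fun S => ∑ x, w x * (if S ∈ 𝒰 x then (1 : ℝ) else 0)) < 0 := by
  refine ⟨fun _ => 1 / 4, famW, fun _ => by norm_num, by norm_num [Fin.sum_univ_four], famW_unionClosed, fun S T => ?_, ?_⟩
  · rw [mixture_famW, mixture_famW, mixture_famW]
    have hS : S.card ≤ 3 := by simpa using card_le_univ S
    have hT : T.card ≤ 3 := by simpa using card_le_univ T
    have hU : (S ∪ T).card ≤ 3 := by simpa using card_le_univ (S ∪ T)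
    have hmax : S.card ≤ (S ∪ T).card := card_le_card subset_union_left
    have hmax' : T.card ≤ (S ∪ T).card := card_le_card subset_union_right
    unfold profile3
    split_ifs <;> (try omega) <;> norm_num
  · have e : (fun S : Finset (Fin 3) => ∑ x : Fin 4, (1 / 4 : ℝ) * (if S ∈ famW x then (1 : ℝ) else 0)) = profile3 := funext mixture_famW
    rw [e, PrincipalCapBeta.phiSet_three]
    have c01 : ({0, 1} : Finset (Fin 3)).card = 2 := by decide
    have c02 : ({0, 2} : Finset (Fin 3)).card = 2 := by decide
    have c12 : ({1, 2} : Finset (Fin 3)).card = 2 := by decide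
    have cu : (univ : Finset (Fin 3)).card = 3 := by decide
    simp only [profile3, c01, c02, c12, cu, card_singleton]
    norm_num

end SHSharp

end Summit.CriticalPhenomena.PercolationContinuityZ3.Theorems
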